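import Summits.Langlands.Langlands.Theses.NonParallelVoid
import Literature.NumberTheory.GaloisRepresentations.ModPGaloisRep
import Literature.NumberTheory.GaloisRepresentations.LocalGaloisGroup
import Literature.NumberTheory.PAdicHodge.FontaineDpst
import Literature.NumberTheory.Automorphic.AdicCompletionResidueCard
import Summits.Langlands.Langlands.Theorems.NonParallelVoidEmptyWeightCoreStubSplitPrime

/-!
# Stub `stub_inertPlace` (line `inert-fl-transfer`, crux `ResidueParallel`, stmt-Langlands-17003)

Local numerology at the place above an INERT prime of a quadratic field `F`: if the rational prime
`p` is unramified in `𝓞 F` and has no two distinct places of `F` above it, then the place `v ∣ p` is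
unique, `e(v|p) = 1` (Mathlib `Algebra.IsUnramifiedIn.ramificationIdx_eq_one`), `f(v|p) = 2` (the
fundamental identity `Σ_{q ∣ p} e_q f_q = [F : ℚ] = 2` over `ℤ`, Mathlib
`Ideal.sum_ramification_inertia_eq_finrank`, has the single summand at `v`), the completion `F_v` has
residue field of cardinality `N v = p²` (`residueFieldCard_adicCompletion_eq`,
`Ideal.absNorm_eq_pow_inertiaDeg'`), `p` is a uniformiser of `F_v`
(`EmptyWeightCore.LocalClauseCut.splitPrime_irreducible_natCast`, needing only `v² ∤ (p)`), and, for
the pinned `ℚ_p`-structure of the summit's Fontaine datum — the canonical one,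
`fontainePstAdicCompletion_algebra_eq_adicCompletionPadicAlgebra` — `[F_v : ℚ_p] = 2` with exactly two
labels `F_v →ₐ[ℚ_p] ℚ̄_p` (Mathlib `AlgHom.card`).

The local degree (Mathlib has no `[F_v : ℚ_p] = e f`): UPPER BOUND — the `ℚ_p`-span of the image of
a `ℚ`-basis of `F` is finite-dimensional, hence closed (`Submodule.closed_of_finiteDimensional`), and
contains the dense image of `F`, so `F_v` is finite over `ℚ_p` of dimension `≤ [F : ℚ] = 2`;
LOWER BOUND — if `[F_v : ℚ_p] = 1` then `ℚ_p → F_v` is onto, the canonical map pulls `𝒪_{F_v}`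
back into `ℤ_p` (an element of `ℚ_p ∖ ℤ_p` is `(p z)⁻¹`, of valuation `> 1`), so
`ℤ_p → 𝒪_{F_v} → 𝓀_{F_v}` is onto and kills `p`: the residue field is a quotient of `ℤ/p` and has
`≤ p < p²` elements.

Reference: Neukirch, *Algebraic Number Theory* (1999), Ch. I §8 Prop. (8.2) (`Σ eᵢ fᵢ = n`),
Ch. II §6 (local degree `e f`).  No `sorry`, no new definitions.
-/

-- project-wide option (lakefile weak.linter.dupNamespace); `Summit.Langlands.Langlands` is mandated
set_option linter.dupNamespace false

noncomputable section

open scoped NumberField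
open Literature.NumberTheory.GaloisRepresentations Literature.NumberTheory.PAdicHodge
open Literature.NumberTheory.GaloisRepresentations.IsNonarchimedeanLocalField (residueFieldCard absMaximalIdeal)
open Field IsDedekindDomain NumberField ValuativeRel

namespace Summit.Langlands.Langlands.Cruxes.ResidueParallel.InertFLTransfer

/-! ### Local fields: the canonical `ℚ_ℓ → K` and the residue field -/

section LocalField

variable (K : Type*) [Field K] [ValuativeRel K] [TopologicalSpace K] [IsNonarchimedeanLocalField K]
  (ℓ : ℕ) [Fact ℓ.Prime] [CharZero K]

/-- **The canonical `ℚ_ℓ → K` pulls `𝒪_K` back to `ℤ_ℓ`.**  For a characteristic-`0` local field `K`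
of residue characteristic `ℓ` and `y ∈ ℚ_ℓ` whose image under `LocalField.padicRingHom` lies in the
valuation ring `𝒪_K`, `‖y‖ ≤ 1`: otherwise `y⁻¹ ∈ ℓ ℤ_ℓ` maps to an element of valuation
`≤ |ℓ|_K < 1`, while `y · y⁻¹ = 1`. [folklore] -/
theorem inertPlace_norm_le_one_of_valuation_padicRingHom_le_one (hℓ : valuation K ℓ < 1)
    (y : ℚ_[ℓ]) (hy : valuation K (LocalField.padicRingHom K ℓ hℓ y) ≤ 1) : ‖y‖ ≤ 1 := by
  by_contra h
  push Not at h
  have hy0 : y ≠ 0 := norm_pos_iff.1 (one_pos.trans h)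
  have hz1 : ‖y⁻¹‖ < 1 := by rw [norm_inv]; exact inv_lt_one_of_one_lt₀ h
  -- `y⁻¹ ∈ ℤ_ℓ` is a non-unit, hence a multiple of `ℓ`
  set z : ℤ_[ℓ] := ⟨y⁻¹, hz1.le⟩
  have hzmem : z ∈ IsLocalRing.maximalIdeal ℤ_[ℓ] := by
    rw [IsLocalRing.mem_maximalIdeal, PadicInt.mem_nonunits]
    exact hz1
  rw [PadicInt.maximalIdeal_eq_span_p, Ideal.mem_span_singleton] at hzmem
  obtain ⟨w, hw⟩ := hzmem
  set φ := LocalField.padicRingHom K ℓ hℓ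
  have hval : valuation K (φ y⁻¹) < 1 := by
    have h1 : (y⁻¹ : ℚ_[ℓ]) = ((z : ℤ_[ℓ]) : ℚ_[ℓ]) := rfl
    rw [h1, hw, PadicInt.coe_mul, PadicInt.coe_natCast, map_mul, map_natCast, map_mul]
    exact (mul_le_mul' le_rfl (LocalField.valuation_padicRingHom_le_one K ℓ hℓ w)).trans_lt
      (by rwa [mul_one])
  have h1 : valuation K (φ y) * valuation K (φ y⁻¹) = 1 := by
    rw [← map_mul, ← map_mul, mul_inv_cancel₀ hy0, map_one, map_one]
  have h2 : valuation K (φ y) * valuation K (φ y⁻¹) < 1 :=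
    (mul_le_mul' hy le_rfl).trans_lt (by rwa [one_mul])
  exact h2.ne h1

/-- **If the canonical `ℚ_ℓ → K` is onto, the residue field of `K` has at most `ℓ` elements.**
Then `ℤ_ℓ → 𝒪_K` is onto (`inertPlace_norm_le_one_of_valuation_padicRingHom_le_one`), so the
composite `ℤ_ℓ → 𝒪_K → 𝓀_K` is a surjective ring homomorphism killing `ℓ ∈ 𝓂_K`; it factors through
`ℤ_ℓ → ℤ/ℓ` (Mathlib `PadicInt.ker_toZMod`, `RingHom.liftOfSurjective`), whence a surjection
`ℤ/ℓ → 𝓀_K` and `q_K = #𝓀_K ≤ ℓ`. [folklore] -/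
theorem inertPlace_residueFieldCard_le_of_surjective_padicRingHom (hℓ : valuation K ℓ < 1)
    (hsurj : Function.Surjective (LocalField.padicRingHom K ℓ hℓ)) : residueFieldCard K ≤ ℓ := by
  -- `ℤ_ℓ → 𝒪_K` is onto
  have hint : Function.Surjective (LocalField.padicIntRingHom K ℓ hℓ) := by
    intro x
    obtain ⟨y, hy⟩ := hsurj (x : K)
    have hy1 : ‖y‖ ≤ 1 :=
      inertPlace_norm_le_one_of_valuation_padicRingHom_le_one K ℓ hℓ y (by rw [hy]; exact x.2)
    refine ⟨⟨y, hy1⟩, Subtype.ext ?_⟩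
    rw [← LocalField.padicRingHom_coe]
    exact hy
  -- `ψ : ℤ_ℓ → 𝓀_K` is onto and kills `ℓ`
  set ψ : ℤ_[ℓ] →+* 𝓀[K] := (IsLocalRing.residue 𝒪[K]).comp (LocalField.padicIntRingHom K ℓ hℓ)
  have hψ : Function.Surjective ψ := IsLocalRing.residue_surjective.comp hint
  have hψℓ : ψ ℓ = 0 := by
    change IsLocalRing.residue 𝒪[K] (LocalField.padicIntRingHom K ℓ hℓ ℓ) = 0
    rw [map_natCast, IsLocalRing.residue_eq_zero_iff]
    exact LocalField.natCast_mem_maximalIdeal hℓ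
  -- hence factors through `ℤ_ℓ → ℤ/ℓ`
  have hsurjZ : Function.Surjective (PadicInt.toZMod (p := ℓ)) := ZMod.ringHom_surjective _
  have hker : RingHom.ker (PadicInt.toZMod (p := ℓ)) ≤ RingHom.ker ψ := by
    rw [PadicInt.ker_toZMod, PadicInt.maximalIdeal_eq_span_p, Ideal.span_le,
      Set.singleton_subset_iff, SetLike.mem_coe, RingHom.mem_ker]
    exact hψℓ
  set χ : ZMod ℓ →+* 𝓀[K] := (PadicInt.toZMod (p := ℓ)).liftOfSurjective hsurjZ ⟨ψ, hker⟩
  have hχ : Function.Surjective χ := by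
    intro t
    obtain ⟨x, rfl⟩ := hψ t
    exact ⟨PadicInt.toZMod x, RingHom.liftOfSurjective_comp_apply _ hsurjZ ⟨ψ, hker⟩ x⟩
  haveI : NeZero ℓ := ⟨(Fact.out : ℓ.Prime).ne_zero⟩
  calc residueFieldCard K = Nat.card 𝓀[K] := rfl
    _ ≤ Nat.card (ZMod ℓ) := Nat.card_le_card_of_surjective χ hχ
    _ = ℓ := Nat.card_zmod ℓ

end LocalField

/-! ### Two labels for a quadratic `ℚ_ℓ`-algebra -/

section Labels

variable (K : Type*) [Field K] (ℓ : ℕ) [Fact ℓ.Prime] [Algebra ℚ_[ℓ] K] [Module.Finite ℚ_[ℓ] K]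

/-- **A field `K` with `[K : ℚ_ℓ] = 2` has exactly two `ℚ_ℓ`-labels `K →ₐ[ℚ_ℓ] ℚ̄_ℓ`**: `K/ℚ_ℓ` is
separable (characteristic `0`) and `ℚ̄_ℓ = PadicAlgCl ℓ` is algebraically closed, so
`#(K →ₐ[ℚ_ℓ] ℚ̄_ℓ) = [K : ℚ_ℓ] = 2` (Mathlib `AlgHom.card`). [folklore] -/
theorem inertPlace_exists_two_algHom_of_finrank_eq_two (h2 : Module.finrank ℚ_[ℓ] K = 2) :
    ∃ τ₁ τ₂ : K →ₐ[ℚ_[ℓ]] PadicAlgCl ℓ, τ₁ ≠ τ₂ ∧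
      ∀ τ : K →ₐ[ℚ_[ℓ]] PadicAlgCl ℓ, τ = τ₁ ∨ τ = τ₂ := by
  have hcard : Nat.card (K →ₐ[ℚ_[ℓ]] PadicAlgCl ℓ) = 2 := by
    rw [← h2, ← Fintype.card_eq_nat_card]
    exact AlgHom.card ℚ_[ℓ] K (PadicAlgCl ℓ)
  obtain ⟨τ₁, τ₂, hne, huniv⟩ := Nat.card_eq_two_iff.1 hcard
  refine ⟨τ₁, τ₂, hne, fun τ => ?_⟩
  have hτ : τ ∈ ({τ₁, τ₂} : Set (K →ₐ[ℚ_[ℓ]] PadicAlgCl ℓ)) := huniv ▸ Set.mem_univ τ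
  simpa only [Set.mem_insert_iff, Set.mem_singleton_iff] using hτ

end Labels

/-! ### The completion `F_v` over `ℚ_p`: `[F_v : ℚ_p] ≤ [F : ℚ]`, and `= 2` at an inert place -/

section Completion

variable {F : Type} [Field F] [NumberField F] (p : ℕ) [Fact p.Prime]
  (v : HeightOneSpectrum (𝓞 F))

/-- **`F_v` is finite over `ℚ_p` of degree `≤ [F : ℚ]`** (canonical `ℚ_p`-structure
`LocalField.adicCompletionPadicAlgebra`, whose structure map is continuous).  The `ℚ_p`-span of the
image of a `ℚ`-basis of `F` is finite-dimensional, hence closed in the Hausdorff topological vector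
space `F_v` over the complete field `ℚ_p` (Mathlib `Submodule.closed_of_finiteDimensional`), and it
contains the image of `F` (rational scalars act through `ℚ_p`, `map_ratCast`), which is dense
(Mathlib `HeightOneSpectrum.denseRange_algebraMap`); so it is everything. [folklore] -/
theorem inertPlace_finite_and_finrank_le (hv : ((p : ℕ) : 𝓞 F) ∈ v.asIdeal) :
    letI := LocalField.adicCompletionPadicAlgebra v p hv
    Module.Finite ℚ_[p] (v.adicCompletion F) ∧
      Module.finrank ℚ_[p] (v.adicCompletion F) ≤ Module.finrank ℚ F := by
  letI := LocalField.adicCompletionPadicAlgebra v p hv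
  haveI : ContinuousSMul ℚ_[p] (v.adicCompletion F) :=
    continuousSMul_of_algebraMap ℚ_[p] (v.adicCompletion F)
      (LocalField.continuous_algebraMap_adicCompletionPadicAlgebra v p hv)
  -- the `ℚ_p`-span `S` of the image of a `ℚ`-basis `b` of `F` is closed
  let b := Module.finBasis ℚ F
  let S : Submodule ℚ_[p] (v.adicCompletion F) :=
    Submodule.span ℚ_[p] (Set.range fun i => algebraMap F (v.adicCompletion F) (b i))
  haveI : FiniteDimensional ℚ_[p] S := Module.Finite.span_of_finite ℚ_[p] (Set.finite_range _)
  have hclosed : IsClosed (S : Set (v.adicCompletion F)) := S.closed_of_finiteDimensional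
  -- `S` contains the image of `F`
  have hF : ∀ x : F, algebraMap F (v.adicCompletion F) x ∈ S := by
    intro x
    rw [← b.sum_repr x, map_sum]
    refine Submodule.sum_mem _ fun i _ => ?_
    rw [Algebra.smul_def, map_mul]
    have hc : algebraMap F (v.adicCompletion F) (algebraMap ℚ F (b.repr x i)) =
        algebraMap ℚ_[p] (v.adicCompletion F) (b.repr x i : ℚ_[p]) := by
      rw [eq_ratCast (algebraMap ℚ F), map_ratCast, map_ratCast]
    rw [hc, ← Algebra.smul_def]
    exact Submodule.smul_mem _ _ (Submodule.subset_span ⟨i, rfl⟩)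
  -- hence `S` is dense, so `S = F_v`
  have hdense : Dense (S : Set (v.adicCompletion F)) :=
    (v.denseRange_algebraMap (K := F)).mono (Set.range_subset_iff.2 hF)
  have hS : S = ⊤ := Submodule.eq_top_iff'.2 fun x => by
    rw [← SetLike.mem_coe, ← hclosed.closure_eq, hdense.closure_eq]
    exact Set.mem_univ x
  have hfin : Module.Finite ℚ_[p] (v.adicCompletion F) := by
    rw [Module.finite_def, ← hS]
    exact Submodule.fg_span (Set.finite_range _)
  refine ⟨hfin, ?_⟩
  calc Module.finrank ℚ_[p] (v.adicCompletion F)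
      = Module.finrank ℚ_[p] (⊤ : Submodule ℚ_[p] (v.adicCompletion F)) :=
        (finrank_top ℚ_[p] (v.adicCompletion F)).symm
    _ = Module.finrank ℚ_[p] S := by rw [hS]
    _ ≤ Fintype.card (Fin (Module.finrank ℚ F)) := finrank_range_le_card _
    _ = Module.finrank ℚ F := Fintype.card_fin _

/-- **`[F_v : ℚ_p] = 1` forces residue cardinality `≤ p`**: then `ℚ_p → F_v` is onto (every element
is a `ℚ_p`-multiple of `1`, Mathlib `finrank_eq_one_iff_of_nonzero'`), and
`inertPlace_residueFieldCard_le_of_surjective_padicRingHom` applies to the local field `F_v`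
(`|p|_v < 1`, `LocalField.valuation_adicCompletion_natCast_lt_one`). [folklore] -/
theorem inertPlace_residueFieldCard_le_of_finrank_eq_one (hv : ((p : ℕ) : 𝓞 F) ∈ v.asIdeal)
    (h1 : letI := LocalField.adicCompletionPadicAlgebra v p hv
      Module.finrank ℚ_[p] (v.adicCompletion F) = 1) :
    residueFieldCard (v.adicCompletion F) ≤ p := by
  letI := LocalField.adicCompletionPadicAlgebra v p hv
  haveI := LocalField.charZero_adicCompletion v
  have hsurj : Function.Surjective (algebraMap ℚ_[p] (v.adicCompletion F)) := by
    intro x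
    obtain ⟨c, hc⟩ :=
      (finrank_eq_one_iff_of_nonzero' (1 : v.adicCompletion F) one_ne_zero).1 h1 x
    exact ⟨c, by rw [Algebra.algebraMap_eq_smul_one]; exact hc⟩
  exact inertPlace_residueFieldCard_le_of_surjective_padicRingHom (v.adicCompletion F) p
    (LocalField.valuation_adicCompletion_natCast_lt_one v p hv) hsurj

/-- **`[F_v : ℚ_p] = 2` at a place of a quadratic field with residue cardinality `p²`**: the degree is
`≤ [F : ℚ] = 2` (`inertPlace_finite_and_finrank_le`), positive, and `≠ 1` because a degree-one
completion has residue cardinality `≤ p < p²` (`inertPlace_residueFieldCard_le_of_finrank_eq_one`).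
This is the case `[F_v : ℚ_p] = e f = 1 · 2` of the local degree formula.
[cite: NeukirchANT1999, Ch. II §6 (local degree e f)] -/
theorem inertPlace_finrank_eq_two [Algebra.IsQuadraticExtension ℚ F]
    (hv : ((p : ℕ) : 𝓞 F) ∈ v.asIdeal) (hq : residueFieldCard (v.adicCompletion F) = p ^ 2) :
    letI := LocalField.adicCompletionPadicAlgebra v p hv
    Module.finrank ℚ_[p] (v.adicCompletion F) = 2 := by
  letI := LocalField.adicCompletionPadicAlgebra v p hv
  obtain ⟨hfin, hle⟩ := inertPlace_finite_and_finrank_le p v hv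
  rw [Algebra.IsQuadraticExtension.finrank_eq_two ℚ F] at hle
  haveI := hfin
  have hpos : 0 < Module.finrank ℚ_[p] (v.adicCompletion F) := Module.finrank_pos
  have hne1 : Module.finrank ℚ_[p] (v.adicCompletion F) ≠ 1 := fun h1 => by
    have hle' := inertPlace_residueFieldCard_le_of_finrank_eq_one p v hv h1
    rw [hq] at hle'
    have hp : p < p ^ 2 := lt_self_pow₀ (Fact.out : p.Prime).one_lt (by norm_num)
    omega
  omega

end Completion

/-! ### Arithmetic at the unique place above `p`: `e f = 2`, `N v = p ^ f` -/

section Arithmetic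

variable {F : Type} [Field F] [NumberField F] (p : ℕ) [Fact p.Prime]

/-- **A unique place above `p` in a quadratic field has `e(v|p) f(v|p) = 2`.**  The fundamental
identity `Σ_{q ∣ p} e_q f_q = [𝓞 F : ℤ] = [F : ℚ] = 2` (Mathlib `Ideal.sum_ramification_inertia_eq_finrank`
over `ℤ`, `NumberField.RingOfIntegers.rank`) has exactly one summand: a prime `q` of `𝓞 F` over `p ℤ`
is non-zero (Mathlib `Ideal.ne_bot_of_liesOver_of_ne_bot`) and contains `p`, so it is `v`.
[cite: NeukirchANT1999, Ch. I §8 Prop. (8.2)] -/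
theorem inertPlace_ramificationIdx_mul_inertiaDeg_eq_two [Algebra.IsQuadraticExtension ℚ F]
    {v : HeightOneSpectrum (𝓞 F)} (hv : ((p : ℕ) : 𝓞 F) ∈ v.asIdeal)
    (huniq : ∀ w : HeightOneSpectrum (𝓞 F), ((p : ℕ) : 𝓞 F) ∈ w.asIdeal → w = v) :
    v.asIdeal.ramificationIdx ℤ * v.asIdeal.inertiaDeg ℤ = 2 := by
  set P : Ideal ℤ := Ideal.span {(p : ℤ)} with hP
  have hsum := Ideal.sum_ramification_inertia_eq_finrank P (𝓞 F)
  rw [RingOfIntegers.rank, Algebra.IsQuadraticExtension.finrank_eq_two ℚ F] at hsum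
  have hP0 : P ≠ ⊥ := by
    rw [hP, Ne, Ideal.span_singleton_eq_bot]; exact_mod_cast (Fact.out : p.Prime).ne_zero
  haveI := EmptyWeightCore.LocalClauseCut.splitPrime_liesOver_span p hv
  -- every prime of `𝓞 F` over `p ℤ` is `v`
  let a : P.primesOver (𝓞 F) := ⟨v.asIdeal, inferInstance, inferInstance⟩
  have hall : ∀ q : P.primesOver (𝓞 F), q = a := by
    intro q
    haveI : q.1.IsPrime := q.2.1
    haveI : q.1.LiesOver P := q.2.2
    have hq0 : q.1 ≠ ⊥ := Ideal.ne_bot_of_liesOver_of_ne_bot hP0 q.1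
    have hpq : ((p : ℕ) : 𝓞 F) ∈ q.1 := by
      have h1 := (Ideal.mem_of_liesOver q.1 P ((p : ℕ) : ℤ)).1 (Ideal.mem_span_singleton_self _)
      rwa [map_natCast] at h1
    have hw := huniq ⟨q.1, q.2.1, hq0⟩ hpq
    exact Subtype.ext (congrArg HeightOneSpectrum.asIdeal hw)
  have huniv : (Finset.univ : Finset (P.primesOver (𝓞 F))) = {a} :=
    Finset.eq_singleton_iff_unique_mem.2 ⟨Finset.mem_univ _, fun q _ => hall q⟩
  rw [huniv, Finset.sum_singleton] at hsum
  exact hsum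

/-- `f(v|p) = 2 ⇒ N v = p²` (`N v = p ^ f(v|p)`, Mathlib `Ideal.absNorm_eq_pow_inertiaDeg'`,
`Ideal.inertiaDeg'_eq_inertiaDeg`). [folklore] -/
theorem inertPlace_residueCard_eq_sq {v : HeightOneSpectrum (𝓞 F)}
    (hv : ((p : ℕ) : 𝓞 F) ∈ v.asIdeal) (hf : v.asIdeal.inertiaDeg ℤ = 2) :
    v.residueCard = p ^ 2 := by
  haveI := EmptyWeightCore.LocalClauseCut.splitPrime_liesOver_span p hv
  haveI := v.isMaximal
  change Ideal.absNorm v.asIdeal = p ^ 2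
  rw [Ideal.absNorm_eq_pow_inertiaDeg' v.asIdeal (Fact.out : p.Prime),
    Ideal.inertiaDeg'_eq_inertiaDeg, hf]

end Arithmetic

/-! ### The stub -/

/-- **STUB 3a — `inertPlace`.**  In a quadratic field `F` with `p` unramified and no two distinct
places above `p`, the place `v ∣ p` is unique and INERT: `e(v|p) = 1`, `f(v|p) = 2`, the completion
`F_v` has residue field of cardinality `p²`, `p` is a uniformiser of `F_v`, `[F_v : ℚ_p] = 2` for the
pinned (= canonical, `fontainePstAdicCompletion_algebra_eq_adicCompletionPadicAlgebra`) `ℚ_p`-structure,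
and there are exactly two labels `τ₁ ≠ τ₂ : F_v →ₐ[ℚ_p] ℚ̄_p` (Mathlib
`Algebra.IsUnramifiedIn.ramificationIdx_eq_one`; `inertPlace_ramificationIdx_mul_inertiaDeg_eq_two`;
`residueFieldCard_adicCompletion_eq` with `inertPlace_residueCard_eq_sq`; the uniformiser
`EmptyWeightCore.LocalClauseCut.splitPrime_irreducible_natCast`; `inertPlace_finrank_eq_two`;
`inertPlace_exists_two_algHom_of_finrank_eq_two`).
[cite: NeukirchANT1999, Ch. I §8 Prop. (8.2), Ch. II §6 (local degree e f)] -/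
theorem stub_inertPlace :
    ∀ (F : Type) [Field F] [NumberField F] [Algebra.IsQuadraticExtension ℚ F] (p : ℕ) [Fact p.Prime],
      Algebra.IsUnramifiedIn (NumberField.RingOfIntegers F) (Ideal.span {(p : ℤ)}) →
      (¬ ∃ v w : IsDedekindDomain.HeightOneSpectrum (NumberField.RingOfIntegers F), v ≠ w ∧
          ((p : ℕ) : NumberField.RingOfIntegers F) ∈ v.asIdeal ∧ ((p : ℕ) : NumberField.RingOfIntegers F) ∈ w.asIdeal) →
      ∀ (v : IsDedekindDomain.HeightOneSpectrum (NumberField.RingOfIntegers F))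
        (hv : ((p : ℕ) : NumberField.RingOfIntegers F) ∈ v.asIdeal),
        (∀ w : IsDedekindDomain.HeightOneSpectrum (NumberField.RingOfIntegers F),
            ((p : ℕ) : NumberField.RingOfIntegers F) ∈ w.asIdeal → w = v) ∧
        v.asIdeal.ramificationIdx ℤ = 1 ∧ v.asIdeal.inertiaDeg ℤ = 2 ∧
        residueFieldCard (v.adicCompletion F) = p ^ 2 ∧
        Irreducible ((p : ℕ) : 𝒪[v.adicCompletion F]) ∧
        (letI := (Literature.NumberTheory.PAdicHodge.fontainePstAdicCompletion v p hv).algebra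
         Module.finrank ℚ_[p] (v.adicCompletion F) = 2 ∧
         ∃ τ₁ τ₂ : v.adicCompletion F →ₐ[ℚ_[p]] PadicAlgCl p, τ₁ ≠ τ₂ ∧
           ∀ τ : v.adicCompletion F →ₐ[ℚ_[p]] PadicAlgCl p, τ = τ₁ ∨ τ = τ₂) := by
  intro F _ _ _ p _ hunr hnosplit v hv
  -- uniqueness of the place above `p`
  have huniq : ∀ w : HeightOneSpectrum (𝓞 F), ((p : ℕ) : 𝓞 F) ∈ w.asIdeal → w = v := by
    intro w hw
    by_contra hne
    exact hnosplit ⟨w, v, hne, hw, hv⟩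
  -- `e = 1`, `f = 2`
  haveI := EmptyWeightCore.LocalClauseCut.splitPrime_liesOver_span p hv
  have he : v.asIdeal.ramificationIdx ℤ = 1 :=
    Algebra.IsUnramifiedIn.ramificationIdx_eq_one hunr inferInstance
  have hef := inertPlace_ramificationIdx_mul_inertiaDeg_eq_two p hv huniq
  have hf : v.asIdeal.inertiaDeg ℤ = 2 := by rw [he, one_mul] at hef; exact hef
  -- residue cardinality of `F_v` and the uniformiser `p`
  have hq : residueFieldCard (v.adicCompletion F) = p ^ 2 := by
    rw [Literature.NumberTheory.Automorphic.residueFieldCard_adicCompletion_eq F v]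
    exact inertPlace_residueCard_eq_sq p hv hf
  have hirr : Irreducible ((p : ℕ) : 𝒪[v.adicCompletion F]) :=
    EmptyWeightCore.LocalClauseCut.splitPrime_irreducible_natCast p hv
      (EmptyWeightCore.LocalClauseCut.splitPrime_not_sq_dvd p hv he)
  refine ⟨huniq, he, hf, hq, hirr, ?_⟩
  -- the pinned `ℚ_p`-structure is the canonical one
  rw [fontainePstAdicCompletion_algebra_eq_adicCompletionPadicAlgebra v p hv]
  letI := LocalField.adicCompletionPadicAlgebra v p hv
  have h2 := inertPlace_finrank_eq_two p v hv hq
  haveI := (inertPlace_finite_and_finrank_le p v hv).1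
  exact ⟨h2, inertPlace_exists_two_algHom_of_finrank_eq_two (v.adicCompletion F) p h2⟩

end Summit.Langlands.Langlands.Cruxes.ResidueParallel.InertFLTransfer

end
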